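import Summits.BirchSwinnertonDyer.Rank1Residual.GaloisImage.KolyvaginTransverseLocalValues

/-!
# The modified `T`-level derivative classes and the augmentation-square lemma for an Euler system
# — file 3 of row T-DER-TR (THEOREM D-tr of T-DER: the derivative class is transverse at the
# primes of its level; cell `b2b-bsdres`, team n1011, seat p15 GEN 8, OWNERS row T-DER-TR =
# skel/T-DER-TR.md)

HONEST FRAMING (cell `b2b-bsdres`, run/shared/lean/b2b/bsd-rank1-residual/, verbatim in every
file): the goal of the cell is to DELETE the COMBINATION-SHAPED residual classes of the
Birch–Swinnerton-Dyer formula for ALL analytic-rank `≤ 1` elliptic curves over `ℚ` — "full BSD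
formula for every rank `≤ 1` curve in class `C`" assembled STRICTLY from published theorems — so
that the rank-`≤ 1` remainder becomes exactly the CONSTRUCTION-SHAPED classes, which are TYPED
(missing-input `Prop`s), NOT attempted. This is not "finishing BSD". Team n1011: research route on
the CONSTRUCTION-SHAPED class X4 / §I N11 (route-1 PORT, (P-DER)); TOOL theorems of continuous
group cohomology (no definition, no named fact, no `sorry`); curve-free, `p`-free.

## What ([MR04] App. A, Lemma A.10–A.12 for the tree's `IsEulerSystem`, in the `(X−1)²` case)

Setting: `L : EulerSystemLevels K ι`, `T : GaloisRep K A M`, an Euler system `c` (`IsEulerSystem`),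
a level `n : L.Ideals` with a distinguished `q ∈ n`, the chosen generators `σ_ℓ`, integers `N_ℓ`
and arithmetic Frobenii `Fr_ℓ` of THEOREM A (F3b/F4's binders `hσ hcov hinj hFr hram`, verbatim),
`U := L.level ⊥ n` and `X := H¹(U, T)` — the `T`-LEVEL classes (not reduced).  The operators
`E_ℓ = conj(σ_ℓ)`, `F_ℓ = conj(Fr_ℓ⁻¹)` (`frobeniusInvOp`), the classes `x_m = res_U c_{⊥,m}`
(`m ⊆ n`), an auxiliary polynomial `E_q ∈ A[X]` with the operator `𝐙 := E_q(F_q)` and the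
**modified classes** `x″_m := x_m − 𝐙 x_{m∖q}` (`q ∈ m`), `x″_m := x_m` (`q ∉ m`) — [MR04]'s
change of Euler factor at `q` from the tree's `P_q(Fr⁻¹ ∣ T*; X)` to `P°_q := P_q − N_q E_q`
(for `T_pE` and K4's `E_q`: `P°_q = 1 − a_q X + q X²`, which annihilates `T_pE` — so the modified
classes VANISH at the primes above `q`, the Euler-system congruence [MR04] L. A.10 (i) /
[Ru00] Cor. 4.8.1, here p11's C0d/E2).
* §1/§2 (local coboundary values, words in the `E_ℓ`) are file 3a `KolyvaginTransverseLocalValues`.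
* MAIN `sub_conjMap_noncommProd_deriv_mem_smul_localVanishing`: with `S` = the classes all of whose
  representatives take coboundary values at a conjugation-invariant marked set `𝒢 ⊆ U` and
  `V := I • S`: the norm relations (R2″) of `x″` are PROVED here from F3a
  `sum_conjMap_pow_resLe_eq_eulerFactorOp` (at `ℓ = q` with `P°_q`; referee-1 GEN 39 proviso (i)),
  then file 1's `sub_one_apply_noncommProd_deriv_apply_mem_of_eulerFamily_sq` gives `D_n x″_n ∈ S`
  and `conj(g) (D_n x″_n) − D_n x″_n ∈ I • S` for every `g ∈ tameLevel q`, the word hypothesis being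
  DERIVED from the displayed `hg` (proviso (ii)); `x″_m ∈ S` (`hvan`), `I ∣ N_ℓ` and the Kolyvagin
  congruences of the Euler polynomials mod `I` are DISPLAYED.  File 3b assembles with file 2.

References: B. Mazur, K. Rubin, *Kolyvagin systems*, Mem. AMS 799 (2004), App. A pp. 83–86;
K. Rubin, *Euler Systems* (2000), §4.4, Cor. 4.8.1; B. Perrin-Riou, Ann. Inst. Fourier 48 (1998),
Prop. 2.2.5 (ii).
-/

noncomputable section

open CategoryTheory Function Finset Polynomial Field IsDedekindDomain
open scoped NumberField Classical
open Literature.NumberTheory.GaloisRepresentations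
open Literature.NumberTheory.EllipticCurves (subgroupInclusion subgroupConj subgroupConj_apply_coe)

universe u v w

namespace Summit.BirchSwinnertonDyer.Rank1Residual.GaloisImage

namespace Derivative

namespace Transverse

/-! ### §3 The instantiation: the modified classes `x″` form an Euler family with square Euler
factors, taking coboundary values at the marked elements -/

section Instantiation

variable {K : Type u} [Field K] [NumberField K] {ι : Type w} [Preorder ι] [OrderBot ι]
variable {A : Type v} [CommRing A] [TopologicalSpace A]
variable {M : Type u} [AddCommGroup M] [Module A M] [TopologicalSpace M] [IsTopologicalAddGroup M]
  [ContinuousSMul A M] [Module.Free A M] [Module.Finite A M]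
variable {L : EulerSystemLevels K ι} {T : GaloisRep K A M} {p : ℕ} [Fact p.Prime] [Algebra ℤ_[p] A]
variable {c : ∀ (i : ι) (r : L.Ideals), H1 T (L.level i r.1)}

/-- **The augmentation-square lemma for the modified derivative classes of an Euler system**
([MR04] App. A, Lemma A.10–A.12 in the `(X−1)²` case, for the tree's `IsEulerSystem`).  Data: an
Euler system `c`, a level `n` with THEOREM A's generators `σ_ℓ` (`hσ hcov hinj`), Frobenii `Fr_ℓ`
(`hFr`, `hram`), a prime `q ∈ n`, a scalar `I ∈ A` (`= M`, the modulus of the derivative classes)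
dividing every `N_ℓ`, an auxiliary polynomial `E_q` with the KOLYVAGIN CONGRUENCES of the Euler
polynomials `P_ℓ ≡ (X−1)² mod I` (`ℓ ≠ q`) and `P_q − N_q E_q ≡ (X−1)² mod I` DISPLAYED (for `T_pE`:
K1/K4 + `Kato.IsKolyvaginPrime`), a conjugation-invariant set `𝒢 ⊆ U_n` of marked elements (the
Frobenius powers above `q`), and the SEMI-LOCAL CONGRUENCE displayed: every modified class
`x″_{mq} = res c_{⊥,mq} − E_q(Fr_q⁻¹) res c_{⊥,m}` (`q ∉ m`, `mq ⊆ n`) has a representative taking a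
coboundary value at each `g ∈ 𝒢` (`hvan`; for `T_pE` p11's E2 `exists_sub_eq_sub_one_apply_frobenius_pow_bot`
/ C0d).  Conclusion, with `U = L.level ⊥ n`, `D_n = n.noncommProd (Σ_j j conj(σ_ℓ)^j)` on `H¹(U, T)`
and `x″_n = c_{⊥,n} − E_q(Fr_q⁻¹) res c_{⊥,n∖q}`: (1) every representative of `D_n x″_n` takes a
coboundary value at every `g ∈ 𝒢`; (2) for every `g ∈ tameLevel q` there is a class `s` with the same
property and `conj(g) (D_n x″_n) − D_n x″_n = I • s`.
[cite: MazurRubin2004, App. A, Lemma A.12 (p. 85)] -/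
theorem sub_conjMap_noncommProd_deriv_mem_smul_localVanishing (hc : IsEulerSystem L T p c)
    (n : L.Ideals)
    (σ : HeightOneSpectrum (𝓞 K) → absoluteGaloisGroup K) (N : HeightOneSpectrum (𝓞 K) → ℕ)
    (Fr : HeightOneSpectrum (𝓞 K) → absoluteGaloisGroup K)
    (hσ : ∀ ℓ ∈ n.1, ∀ q ∈ n.1, q ≠ ℓ → σ ℓ ∈ L.tameLevel q)
    (hcov : ∀ ℓ ∈ n.1, ∀ g : absoluteGaloisGroup K, ∃ j < N ℓ, (σ ℓ ^ j)⁻¹ * g ∈ L.tameLevel ℓ)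
    (hinj : ∀ ℓ ∈ n.1, ∀ j₁ < N ℓ, ∀ j₂ < N ℓ, (σ ℓ ^ j₁)⁻¹ * σ ℓ ^ j₂ ∈ L.tameLevel ℓ → j₁ = j₂)
    (hN1 : ∀ ℓ ∈ n.1, 1 ≤ N ℓ)
    (hFr : ∀ ℓ ∈ n.1, IsArithFrobAtPlace K ℓ (Fr ℓ))
    (hram : ∀ ℓ ∈ n.1, ∀ s ⊆ n.1, ℓ ∉ s → ¬ SubgroupIsUnramifiedAt K (L.level ⊥ (insert ℓ s)) ℓ)
    (comm) {q : HeightOneSpectrum (𝓞 K)} (hq : q ∈ n.1) (Eq : A[X]) (I : A)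
    (hIN : ∀ ℓ ∈ n.1, ∃ a : A, (N ℓ : A) = I * a)
    (hPℓ : ∀ ℓ ∈ n.1, ℓ ≠ q → ∃ R : A[X],
      rubinEulerFactor T.toRepresentation (cyclotomicCharacterToUnits K p A) (Fr ℓ) =
        (Polynomial.X - C 1) ^ 2 + C I * R)
    (hPq : ∃ R : A[X],
      rubinEulerFactor T.toRepresentation (cyclotomicCharacterToUnits K p A) (Fr q) - C (N q : A) * Eq =
        (Polynomial.X - C 1) ^ 2 + C I * R)
    (𝒢 : Set (absoluteGaloisGroup K)) (h𝒢U : ∀ g ∈ 𝒢, g ∈ L.level ⊥ n.1)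
    (h𝒢 : ∀ g ∈ 𝒢, ∀ h : absoluteGaloisGroup K, h⁻¹ * g * h ∈ 𝒢)
    (hvan : ∀ (m : L.Ideals) (h₁ : L.level ⊥ n.1 ≤ L.level ⊥ (m.cons q (n.2 q hq)).1)
      (h₂ : L.level ⊥ n.1 ≤ L.level ⊥ m.1), q ∉ m.1 → ∀ g (hg : g ∈ 𝒢),
      ∃ (φ : contOneCocycles (subgroupRep T.toTopRep (L.level ⊥ n.1))) (w : M),
        oneCocycleClass _ φ = resLe T.toTopRep h₁ 1 (c ⊥ (m.cons q (n.2 q hq))) -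
          aeval (frobeniusInvOp T (L.level ⊥ n.1) (Fr q)) Eq (resLe T.toTopRep h₂ 1 (c ⊥ m)) ∧
        φ.1 ⟨g, h𝒢U g hg⟩ = T.toTopRep.ρ g w - w)
    (g : absoluteGaloisGroup K) (hg : g ∈ L.tameLevel q) :
    (∀ g₀ (hg₀ : g₀ ∈ 𝒢), ∀ φ : contOneCocycles (subgroupRep T.toTopRep (L.level ⊥ n.1)),
      oneCocycleClass _ φ =
        (n.1.noncommProd (fun ℓ => ∑ j ∈ range (N ℓ), (j : Module.End A (H1 T (L.level ⊥ n.1))) *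
            (conjMap T.toTopRep (L.level ⊥ n.1) (σ ℓ) 1).hom.toLinearMap ^ j) comm)
          (c ⊥ n - aeval (frobeniusInvOp T (L.level ⊥ n.1) (Fr q)) Eq
            (resLe T.toTopRep (level_antitone L ⊥ (Finset.erase_subset q n.1)) 1
              (c ⊥ ⟨n.1.erase q, fun ℓ hℓ => n.2 ℓ (Finset.erase_subset q n.1 hℓ)⟩))) →
      ∃ w : M, φ.1 ⟨g₀, h𝒢U g₀ hg₀⟩ = T.toTopRep.ρ g₀ w - w) ∧
    ∃ s : H1 T (L.level ⊥ n.1),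
      (∀ g₀ (hg₀ : g₀ ∈ 𝒢), ∀ φ : contOneCocycles (subgroupRep T.toTopRep (L.level ⊥ n.1)),
        oneCocycleClass _ φ = s → ∃ w : M, φ.1 ⟨g₀, h𝒢U g₀ hg₀⟩ = T.toTopRep.ρ g₀ w - w) ∧
      conjMap T.toTopRep (L.level ⊥ n.1) g 1
          ((n.1.noncommProd (fun ℓ => ∑ j ∈ range (N ℓ), (j : Module.End A (H1 T (L.level ⊥ n.1))) *
            (conjMap T.toTopRep (L.level ⊥ n.1) (σ ℓ) 1).hom.toLinearMap ^ j) comm)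
          (c ⊥ n - aeval (frobeniusInvOp T (L.level ⊥ n.1) (Fr q)) Eq
            (resLe T.toTopRep (level_antitone L ⊥ (Finset.erase_subset q n.1)) 1
              (c ⊥ ⟨n.1.erase q, fun ℓ hℓ => n.2 ℓ (Finset.erase_subset q n.1 hℓ)⟩)))) -
        (n.1.noncommProd (fun ℓ => ∑ j ∈ range (N ℓ), (j : Module.End A (H1 T (L.level ⊥ n.1))) *
            (conjMap T.toTopRep (L.level ⊥ n.1) (σ ℓ) 1).hom.toLinearMap ^ j) comm)
          (c ⊥ n - aeval (frobeniusInvOp T (L.level ⊥ n.1) (Fr q)) Eq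
            (resLe T.toTopRep (level_antitone L ⊥ (Finset.erase_subset q n.1)) 1
              (c ⊥ ⟨n.1.erase q, fun ℓ hℓ => n.2 ℓ (Finset.erase_subset q n.1 hℓ)⟩))) = I • s := by
  classical
  set U : Subgroup (absoluteGaloisGroup K) := L.level ⊥ n.1 with hUdef
  let X := H1 T U
  let E : HeightOneSpectrum (𝓞 K) → Module.End A X := fun ℓ => (conjMap T.toTopRep U (σ ℓ) 1).hom.toLinearMap
  let F : HeightOneSpectrum (𝓞 K) → Module.End A X := fun ℓ => frobeniusInvOp T U (Fr ℓ)
  let P : HeightOneSpectrum (𝓞 K) → A[X] := fun ℓ =>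
    rubinEulerFactor T.toRepresentation (cyclotomicCharacterToUnits K p A) (Fr ℓ)
  let P'' : HeightOneSpectrum (𝓞 K) → A[X] := fun ℓ => if ℓ = q then P q - C (N q : A) * Eq else P ℓ
  let Z : Module.End A X := aeval (F q) Eq
  have hqp : q ∈ L.primes := n.2 q hq
  have hUle : ∀ {s : Finset (HeightOneSpectrum (𝓞 K))}, s ⊆ n.1 → U ≤ L.level ⊥ s :=
    fun hs => level_antitone L ⊥ hs
  let x : Finset (HeightOneSpectrum (𝓞 K)) → X := fun s =>
    if hs : s ⊆ n.1 then resLe T.toTopRep (hUle hs) 1 (c ⊥ ⟨s, fun ℓ hℓ => n.2 ℓ (hs hℓ)⟩) else 0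
  have hx : ∀ {s} (hs : s ⊆ n.1),
      x s = resLe T.toTopRep (hUle hs) 1 (c ⊥ ⟨s, fun ℓ hℓ => n.2 ℓ (hs hℓ)⟩) := fun hs => dif_pos hs
  let x'' : Finset (HeightOneSpectrum (𝓞 K)) → X := fun s =>
    if q ∈ s then x s - Z (x (s.erase q)) else x s
  have hx''q : ∀ {s}, q ∈ s → x'' s = x s - Z (x (s.erase q)) := fun hs => if_pos hs
  have hx''n : ∀ {s}, q ∉ s → x'' s = x s := fun hs => if_neg hs
  have hσN : ∀ ℓ ∈ n.1, σ ℓ ^ N ℓ ∈ U := fun ℓ hℓ =>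
    mem_level_of_forall L (by rw [L.pLevel_bot]; exact Subgroup.mem_top _) fun q' hq' => by
      by_cases hqℓ : q' = ℓ
      · subst hqℓ; exact pow_mem_tameLevel_of_cov_inj L (hcov q' hq') (hinj q' hq')
      · exact Subgroup.pow_mem _ (hσ ℓ hℓ q' hq' hqℓ) _
  have hσUs : ∀ {s} (hs : s ⊆ n.1), ∀ ℓ ∈ n.1, ℓ ∉ s → σ ℓ ∈ L.level ⊥ s :=
    fun hs ℓ hℓ hℓs => mem_level_of_forall L (by rw [L.pLevel_bot]; exact Subgroup.mem_top _)
      fun q' hq' => hσ ℓ hℓ q' (hs hq') (fun h => hℓs (h ▸ hq'))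
  have hEE : ∀ a b, Commute (E a) (E b) := fun a b => commute_conjMap_hom_level ⊥ n.1 (σ a) (σ b)
  have hFE : ∀ a b, Commute (F a) (E b) := fun a b => commute_conjMap_hom_level ⊥ n.1 (Fr a)⁻¹ (σ b)
  have hZE : ∀ b, Commute Z (E b) := fun b => (commute_aeval_of_commute (hFE q b).symm Eq).symm
  have hZF : ∀ a, Commute Z (F a) := fun a =>
    (commute_aeval_of_commute (commute_conjMap_hom_level ⊥ n.1 (Fr a)⁻¹ (Fr q)⁻¹) Eq).symm
  have hfix0 : ∀ s ⊆ n.1, ∀ ℓ ∈ n.1, ℓ ∉ s → E ℓ (x s) = x s := by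
    intro s hs ℓ hℓ hℓs
    rw [hx hs]
    change conjMap T.toTopRep U (σ ℓ) 1 _ = _
    rw [← resLe_conjMap, conjMap_eq_self_of_mem T.toTopRep (hσUs hs ℓ hℓ hℓs)]
  have hfix : ∀ s ⊆ n.1, ∀ ℓ ∈ n.1, ℓ ∉ s → E ℓ (x'' s) = x'' s := by
    intro s hs ℓ hℓ hℓs
    by_cases hqs : q ∈ s
    · rw [hx''q hqs, map_sub, hfix0 s hs ℓ hℓ hℓs, (apply_comm_of_commute (hZE ℓ) _).symm,
        hfix0 (s.erase q) ((Finset.erase_subset q s).trans hs) ℓ hℓ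
          (fun h => hℓs (Finset.mem_of_mem_erase h))]
    · rw [hx''n hqs, hfix0 s hs ℓ hℓ hℓs]
  have hord : ∀ ℓ ∈ n.1, E ℓ ^ N ℓ = 1 := by
    intro ℓ hℓ
    refine LinearMap.ext fun y => ?_
    change ((conjMap T.toTopRep U (σ ℓ) 1).hom.toLinearMap ^ N ℓ) y = y
    rw [conjMap_hom_pow_apply, conjMap_eq_self_of_mem T.toTopRep (hσN ℓ hℓ)]
  have hnorm0 : ∀ s ⊆ n.1, ∀ ℓ ∈ s,
      (∑ j ∈ range (N ℓ), E ℓ ^ j) (x s) = aeval (F ℓ) (P ℓ) (x (s.erase ℓ)) := by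
    intro s hs ℓ hℓ
    have hs' : s.erase ℓ ⊆ n.1 := (Finset.erase_subset ℓ s).trans hs
    have hℓs' : ℓ ∉ s.erase ℓ := Finset.notMem_erase ℓ s
    let r₀ : L.Ideals := ⟨s.erase ℓ, fun q hq => n.2 q (hs' hq)⟩
    have hℓp : ℓ ∈ L.primes := n.2 ℓ (hs hℓ)
    have hcons : (r₀.cons ℓ hℓp).1 = s := Finset.insert_erase hℓ
    have hsub : (⟨s, fun q hq => n.2 q (hs hq)⟩ : L.Ideals) = r₀.cons ℓ hℓp := Subtype.ext hcons.symm
    have hUc : U ≤ L.level ⊥ (r₀.cons ℓ hℓp).1 := hcons.symm ▸ hUle hs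
    have hσ₀ : σ ℓ ∈ L.level ⊥ r₀.1 := hσUs hs' ℓ (hs hℓ) hℓs'
    have hcov₀ : ∀ g ∈ L.level ⊥ r₀.1, ∃ j < N ℓ, (σ ℓ ^ j)⁻¹ * g ∈ L.level ⊥ (r₀.cons ℓ hℓp).1 := by
      intro g hg
      obtain ⟨j, hj, hjg⟩ := hcov ℓ (hs hℓ) g
      refine ⟨j, hj, ?_⟩
      rw [EulerSystemLevels.Ideals.cons_val]
      have hmem : (σ ℓ ^ j)⁻¹ * g ∈ L.level ⊥ r₀.1 :=
        Subgroup.mul_mem _ (Subgroup.inv_mem _ (Subgroup.pow_mem _ hσ₀ j)) hg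
      rw [EulerSystemLevels.mem_level_iff] at hmem ⊢
      refine ⟨hmem.1, fun q hq => ?_⟩
      rcases Finset.mem_insert.mp hq with rfl | hq
      · exact hjg
      · exact hmem.2 q hq
    have hinj₀ : ∀ j₁ < N ℓ, ∀ j₂ < N ℓ,
        (σ ℓ ^ j₁)⁻¹ * σ ℓ ^ j₂ ∈ L.level ⊥ (r₀.cons ℓ hℓp).1 → j₁ = j₂ := by
      intro j₁ hj₁ j₂ hj₂ hmem
      rw [EulerSystemLevels.Ideals.cons_val, EulerSystemLevels.mem_level_iff] at hmem
      exact hinj ℓ (hs hℓ) j₁ hj₁ j₂ hj₂ (hmem.2 ℓ (Finset.mem_insert_self ℓ _))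
    have hram₀ : ¬ SubgroupIsUnramifiedAt K (L.level ⊥ (r₀.cons ℓ hℓp).1) ℓ := by
      rw [EulerSystemLevels.Ideals.cons_val]
      exact hram ℓ (hs hℓ) (s.erase ℓ) hs' hℓs'
    have key := sum_conjMap_pow_resLe_eq_eulerFactorOp hc ⊥ r₀ ℓ hℓp hℓs' hram₀ (Fr ℓ) (hFr ℓ (hs hℓ))
      hUc (σ ℓ) (N ℓ) hσ₀ hcov₀ hinj₀
    rw [hx hs, hx hs', LinearMap.sum_apply]
    have hcs : resLe T.toTopRep (hUle hs) 1 (c ⊥ ⟨s, fun q hq => n.2 q (hs hq)⟩) =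
        resLe T.toTopRep hUc 1 (c ⊥ (r₀.cons ℓ hℓp)) := by
      clear key hcov₀ hinj₀ hram₀
      revert hUc
      rw [← hsub]
      intro hUc
      rfl
    have hEpow : ∀ (j : ℕ) (y : X), (E ℓ ^ j) y = conjMap T.toTopRep U (σ ℓ ^ j) 1 y :=
      fun j y => conjMap_hom_pow_apply T.toTopRep (σ ℓ) j y
    rw [Finset.sum_congr rfl fun j _ => hEpow j _, hcs]
    exact key
  have hnorm : ∀ s ⊆ n.1, ∀ ℓ ∈ s,
      (∑ j ∈ range (N ℓ), E ℓ ^ j) (x'' s) = aeval (F ℓ) (P'' ℓ) (x'' (s.erase ℓ)) := by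
    intro s hs ℓ hℓ
    have hZN : Commute (∑ j ∈ range (N ℓ), E ℓ ^ j) Z := (commute_norm_of_commute (hZE ℓ) (N ℓ)).symm
    by_cases hℓq : ℓ = q
    · subst hℓq
      have hP'' : P'' ℓ = P ℓ - C (N ℓ : A) * Eq := if_pos rfl
      have hqs' : ℓ ∉ s.erase ℓ := Finset.notMem_erase ℓ s
      rw [hx''q hℓ, hx''n hqs', map_sub, hnorm0 s hs ℓ hℓ, apply_comm_of_commute hZN, hP'', map_sub,
        LinearMap.sub_apply, map_mul, aeval_C, Module.End.mul_apply]
      congr 1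
      -- `N_q (x_{s∖q}) = N_q • x_{s∖q}` since `σ_q` fixes `x_{s∖q}`
      have hfixq : E ℓ (x (s.erase ℓ)) = x (s.erase ℓ) :=
        hfix0 (s.erase ℓ) ((Finset.erase_subset ℓ s).trans hs) ℓ (hs hℓ) hqs'
      have hsum : (∑ j ∈ range (N ℓ), E ℓ ^ j) (x (s.erase ℓ)) = (N ℓ : A) • x (s.erase ℓ) := by
        rw [LinearMap.sum_apply]
        have hpow : ∀ j : ℕ, (E ℓ ^ j) (x (s.erase ℓ)) = x (s.erase ℓ) := fun j => by
          induction j with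
          | zero => rfl
          | succ j ih => rw [pow_succ, Module.End.mul_apply, hfixq, ih]
        rw [Finset.sum_congr rfl fun j _ => hpow j, Finset.sum_const, Finset.card_range,
          ← Nat.cast_smul_eq_nsmul A]
      rw [hsum, map_smul, Module.algebraMap_end_apply]
    · have hP'' : P'' ℓ = P ℓ := if_neg hℓq
      rw [hP'']
      by_cases hqs : q ∈ s
      · have hqs' : q ∈ s.erase ℓ := Finset.mem_erase.mpr ⟨fun h => hℓq h.symm, hqs⟩
        have hℓs' : ℓ ∈ s.erase q := Finset.mem_erase.mpr ⟨hℓq, hℓ⟩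
        rw [hx''q hqs, hx''q hqs', map_sub, map_sub, hnorm0 s hs ℓ hℓ, apply_comm_of_commute hZN,
          hnorm0 (s.erase q) ((Finset.erase_subset q s).trans hs) ℓ hℓs', Finset.erase_right_comm,
          apply_comm_of_commute (commute_aeval_of_commute (hZF ℓ) (P ℓ))]
      · have hqs' : q ∉ s.erase ℓ := fun h => hqs (Finset.mem_of_mem_erase h)
        rw [hx''n hqs, hx''n hqs', hnorm0 s hs ℓ hℓ]
  -- the local-value submodule `S` and `V = I • S`
  let S : Submodule A X :=
    { carrier := {y | ∀ g₀ (hg₀ : g₀ ∈ 𝒢), ∀ φ : contOneCocycles (subgroupRep T.toTopRep U),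
        oneCocycleClass _ φ = y → ∃ w : M, φ.1 ⟨g₀, h𝒢U g₀ hg₀⟩ = T.toTopRep.ρ g₀ w - w}
      zero_mem' := by
        intro g₀ hg₀ φ hφ
        obtain ⟨v, hv⟩ := (oneCocycleClass_eq_zero_iff _ φ).mp hφ
        exact ⟨v, by rw [hv, subgroupRep_ρ_apply]⟩
      add_mem' := by
        intro y₁ y₂ hy₁ hy₂ g₀ hg₀ φ hφ
        obtain ⟨φ₁, hφ₁⟩ := oneCocycleClass_surjective _ y₁
        obtain ⟨w₁, hw₁⟩ := hy₁ g₀ hg₀ φ₁ hφ₁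
        obtain ⟨w₂, hw₂⟩ := hy₂ g₀ hg₀ (φ - φ₁) (by rw [oneCocycleClass_sub, hφ, hφ₁, add_sub_cancel_left])
        refine ⟨w₁ + w₂, ?_⟩
        have h : φ = φ₁ + (φ - φ₁) := by abel
        rw [h, Submodule.coe_add, ContinuousMap.add_apply, hw₁, hw₂, map_add]
        abel
      smul_mem' := by
        intro a y hy g₀ hg₀ φ hφ
        obtain ⟨φ₁, hφ₁⟩ := oneCocycleClass_surjective _ y
        obtain ⟨w₁, hw₁⟩ := hy g₀ hg₀ φ₁ hφ₁
        refine exists_apply_eq_rho_sub_of_oneCocycleClass_eq T.toTopRep U ⟨g₀, h𝒢U g₀ hg₀⟩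
          (ψ := a • φ₁) (by rw [oneCocycleClass_smul, hφ₁, hφ]) (w := a • w₁) ?_
        rw [Submodule.coe_smul, ContinuousMap.smul_apply, hw₁, smul_sub, map_smul] }
  have hSmem : ∀ {y : X}, y ∈ S ↔ ∀ g₀ (hg₀ : g₀ ∈ 𝒢), ∀ φ : contOneCocycles (subgroupRep T.toTopRep U),
      oneCocycleClass _ φ = y → ∃ w : M, φ.1 ⟨g₀, h𝒢U g₀ hg₀⟩ = T.toTopRep.ρ g₀ w - w :=
    fun {y} => Iff.rfl
  let V : Submodule A X := S.map (LinearMap.lsmul A X I)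
  have hVmem : ∀ {v : X}, v ∈ V ↔ ∃ y ∈ S, I • y = v := by
    intro v
    simp only [V, Submodule.mem_map, LinearMap.lsmul_apply]
  have hSconj : ∀ (h : absoluteGaloisGroup K), ∀ y ∈ S, conjMap T.toTopRep U h 1 y ∈ S := by
    intro h y hy
    rw [hSmem] at hy ⊢
    exact forall_apply_eq_rho_sub_conjMap T.toTopRep U 𝒢 h𝒢U h𝒢 h y hy
  have hS : ∀ ℓ ∈ n.1, ∀ y ∈ S, E ℓ y ∈ S := fun ℓ _ y hy => hSconj (σ ℓ) y hy
  have hV : ∀ ℓ ∈ n.1, ∀ y ∈ V, E ℓ y ∈ V := by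
    intro ℓ hℓ v hv
    obtain ⟨y, hy, rfl⟩ := hVmem.mp hv
    exact hVmem.mpr ⟨E ℓ y, hS ℓ hℓ y hy, (map_smul (E ℓ) I y).symm⟩
  have hNV : ∀ ℓ ∈ n.1, ∀ y ∈ S, (N ℓ : A) • y ∈ V := by
    intro ℓ hℓ y hy
    obtain ⟨a, ha⟩ := hIN ℓ hℓ
    exact hVmem.mpr ⟨a • y, S.smul_mem a hy, by rw [ha, mul_smul]⟩
  have hFS : ∀ ℓ, ∀ y ∈ S, F ℓ y ∈ S := fun ℓ y hy => hSconj (Fr ℓ)⁻¹ y hy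
  have hP : ∀ ℓ ∈ n.1, ∃ R : A[X], P'' ℓ = (Polynomial.X - C 1) ^ 2 + R ∧
      ∀ y ∈ S, aeval (F ℓ) R y ∈ V := by
    intro ℓ hℓ
    have aux : ∀ R : A[X], ∀ y ∈ S, aeval (F ℓ) (C I * R) y ∈ V := fun R y hy => by
      rw [map_mul, aeval_C, Module.End.mul_apply, Module.algebraMap_end_apply]
      exact hVmem.mpr ⟨_, aeval_apply_mem_of_forall_mem (F ℓ) R S (hFS ℓ) hy, rfl⟩
    by_cases hℓq : ℓ = q
    · subst hℓq
      obtain ⟨R, hR⟩ := hPq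
      exact ⟨C I * R, by rw [show P'' ℓ = P ℓ - C (N ℓ : A) * Eq from if_pos rfl]; exact hR, aux R⟩
    · obtain ⟨R, hR⟩ := hPℓ ℓ hℓ hℓq
      exact ⟨C I * R, by rw [show P'' ℓ = P ℓ from if_neg hℓq]; exact hR, aux R⟩
  have hxS : ∀ s ⊆ n.1, q ∈ s → x'' s ∈ S := by
    intro s hs hqs
    have hs' : s.erase q ⊆ n.1 := (Finset.erase_subset q s).trans hs
    have hqs' : q ∉ s.erase q := Finset.notMem_erase q s
    let m : L.Ideals := ⟨s.erase q, fun ℓ hℓ => n.2 ℓ (hs' hℓ)⟩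
    have hcons : (m.cons q hqp).1 = s := Finset.insert_erase hqs
    have hsub : (⟨s, fun ℓ hℓ => n.2 ℓ (hs hℓ)⟩ : L.Ideals) = m.cons q hqp := Subtype.ext hcons.symm
    have hUc : U ≤ L.level ⊥ (m.cons q hqp).1 := hcons.symm ▸ hUle hs
    have hcs : resLe T.toTopRep (hUle hs) 1 (c ⊥ ⟨s, fun ℓ hℓ => n.2 ℓ (hs hℓ)⟩) =
        resLe T.toTopRep hUc 1 (c ⊥ (m.cons q hqp)) := by
      revert hUc
      rw [← hsub]
      intro hUc
      rfl
    rw [hSmem, hx''q hqs, hx hs, hx hs', hcs]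
    intro g₀ hg₀ φ hφ
    obtain ⟨φ₀, w, hφ₀, hw⟩ := hvan m hUc (hUle hs') hqs' g₀ hg₀
    exact exists_apply_eq_rho_sub_of_oneCocycleClass_eq T.toTopRep U ⟨g₀, h𝒢U g₀ hg₀⟩
      (hφ.trans hφ₀.symm) hw
  have hFw : ∀ ℓ ∈ n.1, F ℓ ∈ Submonoid.closure (E '' (↑n.1 : Set (HeightOneSpectrum (𝓞 K)))) := by
    intro ℓ _
    obtain ⟨w, hw, hwq⟩ := exists_mem_closure_inv_mul_mem L σ N n.1 hσ hcov (Fr ℓ)⁻¹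
    have hmem : w⁻¹ * (Fr ℓ)⁻¹ ∈ U :=
      mem_level_of_forall L (by rw [L.pLevel_bot]; exact Subgroup.mem_top _) hwq
    exact conjMap_mem_closure_of_inv_mul_mem T U σ N n.1 hσN hN1 hw hmem
  have main := sub_one_apply_noncommProd_deriv_apply_mem_of_eulerFamily_sq E F N P'' n.1 x'' S V q hq
    hEE hFE hFw hfix hord hnorm hS hV hNV hP hxS
  have hxn : x'' n.1 = c ⊥ n - Z (resLe T.toTopRep (level_antitone L ⊥ (Finset.erase_subset q n.1)) 1
      (c ⊥ ⟨n.1.erase q, fun ℓ hℓ => n.2 ℓ (Finset.erase_subset q n.1 hℓ)⟩)) := by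
    rw [hx''q hq, hx subset_rfl, hx (Finset.erase_subset q n.1)]
    exact congrArg₂ _ (resLe_refl_apply T.toTopRep (c ⊥ n)) rfl
  refine ⟨fun g₀ hg₀ φ hφ => ?_, ?_⟩
  · -- (1) `D_n x″_n ∈ S`
    have hmem : (n.1.noncommProd (fun ℓ => ∑ j ∈ range (N ℓ), (j : Module.End A X) * E ℓ ^ j)
        fun a _ b _ _ => commute_deriv_deriv hEE N a b) (x'' n.1) ∈ S :=
      noncommProd_deriv_apply_mem_of_forall_mem E N hEE S n.1 hS (hxS n.1 subset_rfl hq)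
    rw [hSmem] at hmem
    refine hmem g₀ hg₀ φ ?_
    rw [hφ, hxn]
  · -- (2) `conj(g) − 1` moves `D_n x″_n` into `V = I • S`
    obtain ⟨w, hw, hwq⟩ := exists_mem_closure_inv_mul_mem L σ N (n.1.erase q)
      (fun ℓ hℓ q' hq' hne => hσ ℓ (Finset.mem_of_mem_erase hℓ) q' (Finset.mem_of_mem_erase hq') hne)
      (fun ℓ hℓ => hcov ℓ (Finset.mem_of_mem_erase hℓ)) g
    -- `w⁻¹ g ∈ tameLevel q` as well: every generator fixes `K(q)`
    have hwtame : w ∈ L.tameLevel q := by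
      refine (Subgroup.closure_le _).mpr ?_ hw
      rintro _ ⟨ℓ, hℓ, rfl⟩
      have hℓ' := Finset.mem_erase.mp (Finset.mem_coe.mp hℓ)
      exact hσ ℓ hℓ'.2 q hq hℓ'.1.symm
    have hmem : w⁻¹ * g ∈ U := by
      refine mem_level_of_forall L (by rw [L.pLevel_bot]; exact Subgroup.mem_top _) fun q' hq' => ?_
      by_cases hqq : q' = q
      · subst hqq; exact Subgroup.mul_mem _ (Subgroup.inv_mem _ hwtame) hg
      · exact hwq q' (Finset.mem_erase.mpr ⟨hqq, hq'⟩)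
    have hGmem := conjMap_mem_closure_of_inv_mul_mem T U σ N (n.1.erase q)
      (fun ℓ hℓ => hσN ℓ (Finset.mem_of_mem_erase hℓ)) (fun ℓ hℓ => hN1 ℓ (Finset.mem_of_mem_erase hℓ))
      hw hmem
    have hsub : (E '' (↑(n.1.erase q) : Set (HeightOneSpectrum (𝓞 K)))) ⊆ E '' {j | j ∈ n.1 ∧ j ≠ q} := by
      refine Set.image_mono fun j hj => ?_
      have hj' := Finset.mem_erase.mp (Finset.mem_coe.mp hj)
      exact ⟨hj'.2, hj'.1⟩
    have hG := main.2 _ (Submonoid.closure_mono hsub hGmem)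
    obtain ⟨s, hs, hsv⟩ := hVmem.mp hG
    refine ⟨s, fun g₀ hg₀ φ hφ => (hSmem.mp hs) g₀ hg₀ φ hφ, ?_⟩
    rw [hsv, ← hxn]
    rfl

end Instantiation


end Transverse

end Derivative

end Summit.BirchSwinnertonDyer.Rank1Residual.GaloisImage

end
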